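import Literature.MathematicalPhysics.QuantumFieldTheory.Balaban1983to89.B9RWSums344Input

/-!
# `Balaban1983to89.B9RWSums344InputGp` — [B9] the INPUT-side Hölder members (3.44), (3.45) of the random walk sum (3.90) G′(U) PROVED
# inside the leaf of Theorem 3.7 at the all-blocks pin: the G′ twin of `B9RWSums344Input` at n06-c's letters `B9Thm37Whole.Ops`

T. Bałaban, *Propagators for lattice gauge theories in a background field*, Commun. Math. Phys. **99** (1985) 389–434
[`Balaban1985BackgroundPropagators`, "B9"]; [4] = T. Bałaban, *Propagators and renormalization transformations for lattice
gauge theories. II*, Commun. Math. Phys. **96** (1984) 223–250 [`Balaban1984PropagatorsII`].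

statement-level skeleton of published theorems with citation tags; proofs where landed; nothing here is a claim about the
Yang–Mills mass gap

THE PRINTED LOCI (verbatim).  (3.44)–(3.45), p. 398: *"|(∇_UG′(U)∇\*_Uλ)(x)| ≦ B′₀(ε)e^{−δ₀d(y,y′)}(‖λ‖^{ξ′}_ε + |λ|) for 0 < ε ≦ 1,
x ∈ Δ(y), supp λ ⊂ Δ̃(y′) … ‖ζ∇_UG′(U)∇\*_Uλ‖_β ≦ B′₀(ε, β)(L^jη)^{−β}(‖ζ‖^ξ_β + |ζ|)e^{−δ₀d(y,y′)}(‖λ‖^{ξ′}_{β+ε} + |λ|)"*; Theorem 3.7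
p. 409: *"G′ = G′₀(I − R′)⁻¹ … The expansion is convergent in all norms appearing in the inequalities (3.42)–(3.47)"*; (3.88)–(3.89)
p. 409: *"Δ′_aG′₀ = I − Σ_□K(h_□)G′_□h_□ = I − R′"*, *"|(K(h_□)G′_□h_□λ)(x)| ≦ O(M⁻¹)e^{−δ₀(L^jη)⁻¹|y−y′|}|λ|"*; p. 410: *"Theorem 3.7 implies
that all the inequalities (3.42)–(3.47) hold for G′"*.

THE POINT.  `B9RWSums344Input` proves (3.44), (3.45) for the sum G(U) of (3.107) in the block-norm calculus `B11SectG.HasMaj` with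
an input block-norm letter.  THIS FILE is the twin for the sum (3.90) G′(U) at n06-c's `Ops` ∕ `E37AllOfOps`: by G′ = G′₀ + G′R′
((3.88)), ∇_UG′∇\*_U = ∇_UG′₀∇\*_U + (∇_UG′)(R′∇\*_U) — the input legs of the head terms (`InputLegs37`, POSITED), the pin's majorant of
∇_UG′ ∕ the probe majorant of Φ^Y_β∘∇_UG′ (`B9RWSums343HolderGp.holder343_of_local37`), the input bounds of the terms K(h_□)G′_□h_□∇\*_U of
R′∇\*_U (`FactorsInput37`, POSITED — (3.89) from the input Hölder norm with the power (L^jη)⁻¹), ONE composition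
(`B9RWSums344Input.tail_comp`).  §1 schemas + `input3445_of_local37`; §2 ★ `thm37Printed_allPin_inputHolder` — the leaf `B9.Thm37Printed`
at `E37AllOfOps …` with EVERY member of Theorem 3.1 proved inside EXCEPT the single L² line n = 4.

HONEST SCOPE.  Nothing of print is asserted (letters `bH`, readings `InputReads`, legs, factor input bounds = hypotheses of printed
shape; L² line n = 4 displayed).  Kernel-checked bookkeeping; NOT a node discharge, NOT summit progress; one finite lattice paper;
nothing continuum, nothing about the mass gap.  Cell `pub-ymgap` (HUMAN RULING D-0062), Track A node N06 [B9], seat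
`pub-ymgap-dag-n06-k` (rows 18–19, successor gen), 2026-08-27.
-/

namespace Literature.MathematicalPhysics.QuantumFieldTheory.Balaban1983to89.B9RWSums344InputGp

open Literature.MathematicalPhysics.QuantumFieldTheory.Balaban1983to89
open Finset B6RandomWalk B6RandomWalkHom B9Thm37Sum B9Thm34Ext B9Thm37Glue B9Thm37Whole B9Cor38Whole
open B9RWSums343to347Whole B9RWSums346Schur B9Thm37GlueCor36 B9RWSums343Holder B9RWSums343HolderGp B9RWSums346Lap
open B9RWSums344Input B11SectG B9Thm37AllNorms B9Thm37AllNormsInstances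

noncomputable section

/-! ## §1 The sum G′(U) of (3.90) at one member and one U -/

section GpSide

variable {g : B9.Geometry} [Fintype g.Site] [DecidableEq g.Site] {R : ℝ} {H : Prop} {B : B9.Backgrounds}
variable {X Y ι PX PY : Type}

/-- **COROLLARY 3.6's INPUT-SIDE HÖLDER MEMBERS (3.44), (3.45) FOR THE HEAD TERMS h_□G′_□(U)h_□ OF (3.90), LOCALIZED** (the G′ twin of
`InputLegs310`).  POSITED AS A WHOLE; a HYPOTHESIS SCHEMA, Corollary 3.6 is not asserted.
[cite: Balaban1985BackgroundPropagators, Cor. 3.6 p.408 + (3.87) p.409 + (3.44)–(3.45) p.398 + (3.100) p.413] -/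
structure InputLegs37 [Fintype Y] [Fintype PY] (𝔬 : Ops g B X Y ι) (𝔭 : HolderProbes g B X Y PX PY) (R : ℝ) (H : Prop)
    (bH : ℝ → BlockNorm (toB6 g R H) (Y → ℝ)) (SI : ι → Finset g.Site) (BI : ℝ → ℝ) (BI2 : ℝ → ℝ → ℝ) (δ₀ : ℝ)
    (U : B.Cfg) : Prop where
  e4 : ∀ ε : ℝ, 0 < ε → ε ≤ 1 → ∀ i, HasMaj (bH ε) (BlockNorm.ofBlocks (toB6 g R H) 𝔬.blkY)
    (𝔬.D U ∘ₗ ((mulOp (𝔬.h i) * 𝔬.Gsq U i * mulOp (𝔬.h i)) ∘ₗ 𝔬.Dstar U))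
    (fun (a b : g.Site) => (if a ∈ SI i then (1 : ℝ) else 0) * (BI ε * Real.exp (-(δ₀ * g.dist a b))))
  h2 : ∀ ε β : ℝ, 0 < ε → ε ≤ 1 → 0 ≤ β → β < 1 → ∀ i, HasMaj (bH (β + ε)) (BlockNorm.ofBlocks (toB6 g R H) 𝔭.blkPY)
    ((𝔭.ΦY U β ∘ₗ 𝔬.D U) ∘ₗ ((mulOp (𝔬.h i) * 𝔬.Gsq U i * mulOp (𝔬.h i)) ∘ₗ 𝔬.Dstar U))
    (fun (a b : g.Site) => (if a ∈ SI i then (1 : ℝ) else 0) * (BI2 ε β * g.len a ^ (-β) * Real.exp (-(δ₀ * g.dist a b))))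

/-- **THE TERMS K(h_□)G′_□(U)h_□∇\*_U OF R′∇\*_U FROM THE INPUT HÖLDER NORM** ((3.88)–(3.89) p. 409 read against λ ↦ ∇\*_Uλ with the
power (L^jη)⁻¹; p. 398's convention): for every ε > 0 and every □, (P_□∇_U + C_□)G′_□h_□∇\*_U read from `bH ε` into the sharp blocks
has the majorant 1_{S′_□}(y)·θ_I(ε)·(L^jη)⁻¹·e^{−δ₀d(y,y′)}.  POSITED; a HYPOTHESIS SCHEMA.
[cite: Balaban1985BackgroundPropagators, (3.88)–(3.89) p.409 + (3.44) p.398; Balaban1984PropagatorsII, (2.40)–(2.44) p.230] -/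
structure FactorsInput37 [Fintype X] [Fintype Y] (𝔬 : Ops g B X Y ι) (R : ℝ) (H : Prop)
    (bH : ℝ → BlockNorm (toB6 g R H) (Y → ℝ)) (θI : ℝ → ℝ) (δ₀ : ℝ) (U : B.Cfg) : Prop where
  facD : ∀ ε : ℝ, 0 < ε → ∀ i : ι, HasMaj (bH ε) (BlockNorm.ofBlocks (toB6 g R H) 𝔬.blk)
    (((𝔬.P U i ∘ₗ 𝔬.D U + 𝔬.Cop U i) * 𝔬.Gsq U i * mulOp (𝔬.h i)) ∘ₗ 𝔬.Dstar U)
    (fun (y y' : g.Site) => (if y ∈ 𝔬.S' i then (1 : ℝ) else 0) * (θI ε * (g.len y)⁻¹ * Real.exp (-(δ₀ * g.dist y y'))))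

/-- The terms of R′∇\*_U summed with the overlap count N′. [cite: Balaban1985BackgroundPropagators, (3.88)–(3.89) p.409] -/
private theorem factorsInput37_sum [Fintype Y] [Fintype X] [Fintype ι] {𝔬 : Ops g B X Y ι}
    {bH : ℝ → BlockNorm (toB6 g R H) (Y → ℝ)} {θI : ℝ → ℝ} {δ₀ : ℝ} {U : B.Cfg} {N' ε : ℝ}
    (hFI : FactorsInput37 𝔬 R H bH θI δ₀ U) (hε : 0 < ε) (hθ : 0 ≤ θI ε) (hlen : ∀ y : g.Site, 0 ≤ g.len y)
    (hcnt' : ∀ a : g.Site, (∑ i, if a ∈ 𝔬.S' i then (1 : ℝ) else 0) ≤ N') :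
    HasMaj (bH ε) (BlockNorm.ofBlocks (toB6 g R H) 𝔬.blk)
      ((∑ i, (𝔬.P U i ∘ₗ 𝔬.D U + 𝔬.Cop U i) * 𝔬.Gsq U i * mulOp (𝔬.h i)) ∘ₗ 𝔬.Dstar U)
      (fun (y y' : g.Site) => N' * θI ε * (g.len y)⁻¹ * Real.exp (-(δ₀ * g.dist y y'))) := by
  have hsum : (∑ i, (𝔬.P U i ∘ₗ 𝔬.D U + 𝔬.Cop U i) * 𝔬.Gsq U i * mulOp (𝔬.h i)) ∘ₗ 𝔬.Dstar U =
      ∑ i, ((𝔬.P U i ∘ₗ 𝔬.D U + 𝔬.Cop U i) * 𝔬.Gsq U i * mulOp (𝔬.h i)) ∘ₗ 𝔬.Dstar U := by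
    apply LinearMap.ext
    intro μ
    simp only [LinearMap.comp_apply, LinearMap.sum_apply]
  rw [hsum]
  have h := hasMaj_localSum (G := toB6 g R H) (fun i => ((𝔬.P U i ∘ₗ 𝔬.D U + 𝔬.Cop U i) * 𝔬.Gsq U i * mulOp (𝔬.h i)) ∘ₗ 𝔬.Dstar U)
    (fun i (y : g.Site) => if y ∈ 𝔬.S' i then (1 : ℝ) else 0)
    (fun (y y' : g.Site) => θI ε * (g.len y)⁻¹ * Real.exp (-(δ₀ * g.dist y y'))) N'
    (fun y y' => mul_nonneg (mul_nonneg hθ (inv_nonneg.mpr (hlen y))) (Real.exp_nonneg _)) (hFI.facD ε hε) hcnt'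
  exact h.mono fun y y' => le_of_eq (by ring)

omit [Fintype g.Site] [DecidableEq g.Site] in
/-- Algebra of (3.88): G′ = G′₀ + G′R′ ⇒ E∘G′∘∇\* = E∘G′₀∘∇\* + (E∘G′)∘(R′∘∇\*). [folklore] -/
private theorem twoSided_split' {Z Y' : Type} {E : (X → ℝ) →ₗ[ℝ] (Z → ℝ)} {Dst : (Y' → ℝ) →ₗ[ℝ] (X → ℝ)}
    {G G0 W : Module.End ℝ (X → ℝ)} (h : G = G0 + G * W) :
    E ∘ₗ (G ∘ₗ Dst) = E ∘ₗ (G0 ∘ₗ Dst) + (E ∘ₗ G) ∘ₗ (W ∘ₗ Dst) := by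
  conv_lhs => rw [h]
  apply LinearMap.ext
  intro μ
  simp only [LinearMap.comp_apply, LinearMap.add_apply, Module.End.mul_apply, map_add]

/-- **THE INPUT-SIDE HÖLDER MEMBERS (3.44), (3.45) OF THE SUM G′(U) OF (3.90) AT ONE MEMBER AND ONE CONFIGURATION U** — both block-norm
majorants, from G′ = G′₀ + G′R′ ((3.88), `fixedPoint_of_388`) read as ∇_UG′∇\*_U = ∇_UG′₀∇\*_U + (∇_UG′)(R′∇\*_U) and its probe twin: the
input legs summed with N_I, the pin's sup majorant C·L^jη·e^{−δd} of ∇_UG′ resp. the probe majorant of Φ^Y_β∘∇_UG′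
(`B9RWSums343HolderGp.holder343_of_local37` — its inputs are inputs here), the input bounds of R′∇\*_U summed with N′, and `tail_comp`.
Constants `inputConst44 d₁ δ₁ α₁ N_I N′ C L₀ …` ∕ `inputConst45 … (holderConst …) …` at the rate (1 − α)δ.
[cite: Balaban1985BackgroundPropagators, Thm 3.7 (3.87)–(3.90) pp.408–410 + (3.44)–(3.45) p.398; Balaban1984PropagatorsII, (2.52)–(2.55) p.232 + Lemma 2.1 p.234] -/
theorem input3445_of_local37 [Fintype X] [DecidableEq X] [Fintype Y] [DecidableEq Y] [Fintype ι] [Fintype PX]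
    [DecidableEq PX] [Fintype PY] [DecidableEq PY]
    (𝔬 : Ops g B X Y ι) (𝔭 : HolderProbes g B X Y PX PY) (R : ℝ) (H : Prop) (bH : ℝ → BlockNorm (toB6 g R H) (Y → ℝ))
    (d d₁ : ℕ) (δ α L₀ δ₁ α₁ ρ B₁ N N' Cℓ NH NI C : ℝ) (κ : Sizes) (SH SI : ι → Finset g.Site)
    (Bl BV BI θI : ℝ → ℝ) (BI2 : ℝ → ℝ → ℝ) (U : B.Cfg)
    (hB₁ : 0 ≤ B₁) (hδ₁ : 0 ≤ δ₁) (hα₁ : 0 ≤ α₁) (hα₁1 : α₁ ≤ 1) (hN' : 0 ≤ N') (hNH : 0 ≤ NH) (hNI : 0 ≤ NI) (hC : 0 ≤ C)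
    (hδ : 0 ≤ δ) (hδle : δ ≤ (1 - α₁) * δ₁) (hαδ : 0 ≤ α * δ) (hαδ1 : α * δ ≤ δ)
    (hs : StaticOK 𝔬 ρ N N' Cℓ κ) (hκ : κ.Nonneg)
    (hcntH : ∀ a : g.Site, (∑ i, if a ∈ SH i then (1 : ℝ) else 0) ≤ NH)
    (hcntI : ∀ a : g.Site, (∑ i, if a ∈ SI i then (1 : ℝ) else 0) ≤ NI)
    (hBl : ∀ β, 0 ≤ β → β < 1 → 0 ≤ Bl β) (hBV : ∀ β, 0 ≤ β → β < 1 → 0 ≤ BV β)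
    (hBI : ∀ ε, 0 < ε → ε ≤ 1 → 0 ≤ BI ε) (hBI2 : ∀ ε β, 0 < ε → ε ≤ 1 → 0 ≤ β → β < 1 → 0 ≤ BI2 ε β)
    (hθI : ∀ ε, 0 < ε → 0 ≤ θI ε)
    (h261 : Ineq261 d₁ (toB6 g R H) δ₁ α₁) (hF : Facts347 g R H d δ α L₀)
    (hq : N' * (B₁ * Real.exp (δ₁ * ρ) * (κ.kP + κ.kC)) * B6.c1 d₁ δ₁ α₁ ≤ 1 / 2)
    (hl : Local342 𝔬 R H B₁ δ₁ U) (hi : Identities 𝔬 R H U)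
    (hL : HolderLegs37 𝔬 𝔭 R H SH Bl δ₁ U) (hV : HolderV37 𝔬 𝔭 R H BV δ₁ U)
    (hIL : InputLegs37 𝔬 𝔭 R H bH SI BI BI2 δ₁ U) (hFI : FactorsInput37 𝔬 R H bH θI δ₁ U)
    (h1 : HasMajorantHom (g := toB6 g R H) 𝔬.blk 𝔬.blkY (𝔬.D U ∘ₗ 𝔬.Gp U)
      (fun (a b : g.Site) => C * g.len a * Real.exp (-(δ * g.dist a b))))
    (h2 : HasMajorantHom (g := toB6 g R H) 𝔬.blkY 𝔬.blk (𝔬.Gp U ∘ₗ 𝔬.Dstar U)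
      (fun (a b : g.Site) => C * g.len a * Real.exp (-(δ * g.dist a b)))) :
    (∀ ε : ℝ, 0 < ε → ε ≤ 1 → HasMaj (bH ε) (BlockNorm.ofBlocks (toB6 g R H) 𝔬.blkY) (𝔬.D U ∘ₗ (𝔬.Gp U ∘ₗ 𝔬.Dstar U))
        (fun (a b : g.Site) => inputConst44 d₁ δ₁ α₁ NI N' C L₀ (BI ε) (θI ε) * Real.exp (-((1 - α) * δ * g.dist a b)))) ∧
      (∀ ε β : ℝ, 0 < ε → ε ≤ 1 → 0 ≤ β → β < 1 →
        HasMaj (bH (β + ε)) (BlockNorm.ofBlocks (toB6 g R H) 𝔭.blkPY) (𝔭.ΦY U β ∘ₗ (𝔬.D U ∘ₗ (𝔬.Gp U ∘ₗ 𝔬.Dstar U)))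
          (fun (a b : g.Site) => inputConst45 d₁ δ₁ α₁ NI N' L₀ (holderConst d₁ δ₁ α₁ NH N' C (Bl β) (BV β)) (BI2 ε β)
            (θI (β + ε)) * g.len a ^ (-β) * Real.exp (-((1 - α) * δ * g.dist a b)))) := by
  have hlen0 : ∀ y : g.Site, 0 ≤ g.len y := fun y => (hs.lenpos y).le
  have htri : Triangle254 (toB6 g R H) := fun a b c => hs.tri a b c
  have hc1 : 0 ≤ B6.c1 d₁ δ₁ α₁ := c1_nonneg d₁ δ₁ α₁
  have hL₀ : 0 ≤ L₀ := le_trans (le_trans zero_le_one hF.one_le_L) hF.L_le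
  have hαδ₁ : 0 ≤ α₁ * δ₁ := mul_nonneg hα₁ hδ₁
  have hrate : (1 - α) * δ ≤ (1 - α₁) * δ₁ := by nlinarith [hαδ, hδle]
  have hexp : ∀ a b : g.Site, Real.exp (-(δ₁ * g.dist a b)) ≤ Real.exp (-((1 - α) * δ * g.dist a b)) := fun a b =>
    Real.exp_le_exp.mpr (neg_le_neg (mul_le_mul_of_nonneg_right (by nlinarith [hrate, hαδ₁]) (hs.dnn a b)))
  -- (3.88): G′ = G′₀ + G′R′
  have hfix : 𝔬.Gp U = (∑ i, mulOp (𝔬.h i) * 𝔬.Gsq U i * mulOp (𝔬.h i)) +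
      𝔬.Gp U * ∑ i, (𝔬.P U i ∘ₗ 𝔬.D U + 𝔬.Cop U i) * 𝔬.Gsq U i * mulOp (𝔬.h i) :=
    fixedPoint_of_388 hi.inv hi.eq388
  have hsumE : ∀ {Z : Type} (E : (X → ℝ) →ₗ[ℝ] (Z → ℝ)),
      E ∘ₗ ((∑ i, mulOp (𝔬.h i) * 𝔬.Gsq U i * mulOp (𝔬.h i)) ∘ₗ 𝔬.Dstar U) =
        ∑ i, E ∘ₗ ((mulOp (𝔬.h i) * 𝔬.Gsq U i * mulOp (𝔬.h i)) ∘ₗ 𝔬.Dstar U) := by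
    intro Z E
    apply LinearMap.ext
    intro μ
    simp only [LinearMap.comp_apply, LinearMap.sum_apply, map_sum]
  refine ⟨fun ε hε0 hε1 => ?_, fun ε β hε0 hε1 hβ0 hβ1 => ?_⟩
  · have hθ : 0 ≤ θI ε := hθI ε hε0
    have hP := factorsInput37_sum hFI hε0 hθ hlen0 hs.cnt'
    have hS : HasMajorantHom (g := toB6 g R H) 𝔬.blk 𝔬.blkY (𝔬.D U ∘ₗ 𝔬.Gp U)
        (fun (a b : g.Site) => C * (g.len a ^ (0 : ℝ) * g.len a) * Real.exp (-(δ * g.dist a b))) :=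
      hasMajorantHom_mono (g := toB6 g R H) 𝔬.blk 𝔬.blkY h1 fun a b => le_of_eq (by rw [Real.rpow_zero, one_mul])
    have htail := tail_comp (bH ε) 𝔬.blk 𝔬.blkY hF h261 htri hs.symm hs.dnn hs.lenpos hC (mul_nonneg hN' hθ) hαδ1 hrate hS hP
    have hhead := hasMaj_localSum (G := toB6 g R H)
      (fun i => 𝔬.D U ∘ₗ ((mulOp (𝔬.h i) * 𝔬.Gsq U i * mulOp (𝔬.h i)) ∘ₗ 𝔬.Dstar U))
      (fun i (a : g.Site) => if a ∈ SI i then (1 : ℝ) else 0)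
      (fun (a b : g.Site) => BI ε * Real.exp (-(δ₁ * g.dist a b))) NI
      (fun a b => mul_nonneg (hBI ε hε0 hε1) (Real.exp_nonneg _)) (hIL.e4 ε hε0 hε1) hcntI
    rw [twoSided_split' hfix, hsumE]
    refine (hhead.add htail).mono fun a b => ?_
    have hK0 : 0 ≤ NI * BI ε := mul_nonneg hNI (hBI ε hε0 hε1)
    calc NI * (BI ε * Real.exp (-(δ₁ * g.dist a b))) +
          C * (N' * θI ε) * L₀ * B6.c1 d₁ δ₁ α₁ * g.len a ^ (0 : ℝ) * Real.exp (-((1 - α) * δ * g.dist a b))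
        = NI * BI ε * Real.exp (-(δ₁ * g.dist a b)) +
          C * (N' * θI ε) * L₀ * B6.c1 d₁ δ₁ α₁ * Real.exp (-((1 - α) * δ * g.dist a b)) := by
          rw [Real.rpow_zero]; ring
      _ ≤ NI * BI ε * Real.exp (-((1 - α) * δ * g.dist a b)) +
          C * (N' * θI ε) * L₀ * B6.c1 d₁ δ₁ α₁ * Real.exp (-((1 - α) * δ * g.dist a b)) :=
          add_le_add (mul_le_mul_of_nonneg_left (hexp a b) hK0) le_rfl
      _ = inputConst44 d₁ δ₁ α₁ NI N' C L₀ (BI ε) (θI ε) * Real.exp (-((1 - α) * δ * g.dist a b)) := by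
          unfold inputConst44; ring
  · have hβε : 0 < β + ε := by linarith
    have hθ : 0 ≤ θI (β + ε) := hθI (β + ε) hβε
    have hP := factorsInput37_sum hFI hβε hθ hlen0 hs.cnt'
    have hHol := (holder343_of_local37 𝔬 𝔭 R H d₁ δ₁ α₁ ρ B₁ N N' Cℓ NH C δ κ SH Bl BV U hB₁ hδ₁ hα₁ hα₁1 hN' hNH hC hδ hδle
      hs hκ hcntH hBl hBV h261 hq hl hi hL hV h2 β hβ0 hβ1).1
    have hHK : 0 ≤ holderConst d₁ δ₁ α₁ NH N' C (Bl β) (BV β) := by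
      have hb := hBl β hβ0 hβ1
      have hv := hBV β hβ0 hβ1
      unfold holderConst
      positivity
    have hS : HasMajorantHom (g := toB6 g R H) 𝔬.blk 𝔭.blkPY ((𝔭.ΦY U β ∘ₗ 𝔬.D U) ∘ₗ 𝔬.Gp U)
        (fun (a b : g.Site) => holderConst d₁ δ₁ α₁ NH N' C (Bl β) (BV β) * (g.len a ^ (-β) * g.len a) *
          Real.exp (-(δ * g.dist a b))) := by
      refine hasMajorantHom_mono (g := toB6 g R H) 𝔬.blk 𝔭.blkPY hHol fun a b => le_of_eq ?_
      have hr : g.len a ^ (1 - β) = g.len a ^ (-β) * g.len a := by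
        rw [show (1 - β : ℝ) = -β + 1 by ring, Real.rpow_add (hs.lenpos a), Real.rpow_one]
      rw [hr]
    have htail := tail_comp (bH (β + ε)) 𝔬.blk 𝔭.blkPY hF h261 htri hs.symm hs.dnn hs.lenpos hHK (mul_nonneg hN' hθ) hαδ1
      hrate hS hP
    have hhead := hasMaj_localSum (G := toB6 g R H)
      (fun i => (𝔭.ΦY U β ∘ₗ 𝔬.D U) ∘ₗ ((mulOp (𝔬.h i) * 𝔬.Gsq U i * mulOp (𝔬.h i)) ∘ₗ 𝔬.Dstar U))
      (fun i (a : g.Site) => if a ∈ SI i then (1 : ℝ) else 0)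
      (fun (a b : g.Site) => BI2 ε β * g.len a ^ (-β) * Real.exp (-(δ₁ * g.dist a b))) NI
      (fun a b => mul_nonneg (mul_nonneg (hBI2 ε β hε0 hε1 hβ0 hβ1) (Real.rpow_nonneg (hlen0 a) _)) (Real.exp_nonneg _))
      (hIL.h2 ε β hε0 hε1 hβ0 hβ1) hcntI
    have hassoc : 𝔭.ΦY U β ∘ₗ (𝔬.D U ∘ₗ (𝔬.Gp U ∘ₗ 𝔬.Dstar U)) = (𝔭.ΦY U β ∘ₗ 𝔬.D U) ∘ₗ (𝔬.Gp U ∘ₗ 𝔬.Dstar U) := by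
      rw [LinearMap.comp_assoc]
    rw [hassoc, twoSided_split' hfix, hsumE]
    refine (hhead.add htail).mono fun a b => ?_
    have hW : 0 ≤ g.len a ^ (-β) := Real.rpow_nonneg (hlen0 a) _
    have hK0 : 0 ≤ NI * BI2 ε β * g.len a ^ (-β) := mul_nonneg (mul_nonneg hNI (hBI2 ε β hε0 hε1 hβ0 hβ1)) hW
    calc NI * (BI2 ε β * g.len a ^ (-β) * Real.exp (-(δ₁ * g.dist a b))) +
          holderConst d₁ δ₁ α₁ NH N' C (Bl β) (BV β) * (N' * θI (β + ε)) * L₀ * B6.c1 d₁ δ₁ α₁ * g.len a ^ (-β) *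
            Real.exp (-((1 - α) * δ * g.dist a b))
        = NI * BI2 ε β * g.len a ^ (-β) * Real.exp (-(δ₁ * g.dist a b)) +
          holderConst d₁ δ₁ α₁ NH N' C (Bl β) (BV β) * (N' * θI (β + ε)) * L₀ * B6.c1 d₁ δ₁ α₁ *
            (g.len a ^ (-β) * Real.exp (-((1 - α) * δ * g.dist a b))) := by ring
      _ ≤ NI * BI2 ε β * g.len a ^ (-β) * Real.exp (-((1 - α) * δ * g.dist a b)) +
          holderConst d₁ δ₁ α₁ NH N' C (Bl β) (BV β) * (N' * θI (β + ε)) * L₀ * B6.c1 d₁ δ₁ α₁ *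
            (g.len a ^ (-β) * Real.exp (-((1 - α) * δ * g.dist a b))) :=
          add_le_add (mul_le_mul_of_nonneg_left (hexp a b) hK0) le_rfl
      _ = inputConst45 d₁ δ₁ α₁ NI N' L₀ (holderConst d₁ δ₁ α₁ NH N' C (Bl β) (BV β)) (BI2 ε β) (θI (β + ε)) *
            g.len a ^ (-β) * Real.exp (-((1 - α) * δ * g.dist a b)) := by
          unfold inputConst45; ring

omit [Fintype g.Site] [DecidableEq g.Site] in
/-- Arithmetic of «for M sufficiently large»: a size s ≦ θ₀M⁻¹ and M ≧ 2N′B₀e^{δ₀ρ}θ₀c₁ give N′B₀e^{δ₀ρ}sc₁ ≦ ½. [folklore] -/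
private theorem small_of_size₃ {N' B₀ ex s θ₀ c M : ℝ} (hN' : 0 ≤ N') (hB : 0 ≤ B₀ * ex) (hc : 0 ≤ c) (hM : 0 < M)
    (hs : s ≤ θ₀ * M⁻¹) (hbig : 2 * N' * (B₀ * ex * θ₀) * c ≤ M) : N' * (B₀ * ex * s) * c ≤ 1 / 2 := by
  have h1 : N' * (B₀ * ex * s) * c ≤ N' * (B₀ * ex * (θ₀ * M⁻¹)) * c :=
    mul_le_mul_of_nonneg_right (mul_le_mul_of_nonneg_left (mul_le_mul_of_nonneg_left hs hB) hN') hc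
  have h2 : N' * (B₀ * ex * (θ₀ * M⁻¹)) * c = (N' * (B₀ * ex * θ₀) * c) / M := by
    rw [div_eq_mul_inv]
    ring
  have h3 : (N' * (B₀ * ex * θ₀) * c) / M ≤ 1 / 2 := by
    rw [div_le_iff₀ hM]
    linarith
  exact h1.trans (h2.le.trans h3)

end GpSide

/-! ## §2 The leaf of Theorem 3.7 at the all-blocks pin with every member but the L² line n = 4 proved -/

section AllPinsGp

variable {I : Type} {c35 : ℝ} {geo : I → B9.Geometry} {bg : I → B9.Backgrounds}
variable [∀ i, Fintype (geo i).Site] [∀ i, DecidableEq (geo i).Site]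

/-- ★ **THEOREM 3.7 AT THE ALL-BLOCKS PIN WITH EVERY MEMBER OF THEOREM 3.1 PROVED INSIDE EXCEPT THE L² LINE n = 4** — the sibling
`B9RWSums346Lap.thm37Printed_allPin_schur_holder_lap` with its (3.44), (3.45) conjuncts SUPPLIED (`input3445_of_local37` +
`lines3445_of_hasMaj`): the displayed residual is the single two-sided L² line ‖h∇_UG′∇\*_Uλ‖ (`hrest`).  Inputs beyond the sibling's:
the input block-norm letters `bH i ε` with the co-reading `InputReads`; per member and per U under Corollary 3.6's provisos the input
legs and the input bounds of the R′∇\*_U-terms (`InputLegs37`, `FactorsInput37`, overlap count N_I); αδ ≦ δ; B′₀(ε) ≧ `inputConst44 …`,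
B′₀(ε,β) ≧ `inputConst45 …`.  Nothing of print asserted; NOT a node discharge.
[cite: Balaban1985BackgroundPropagators, Thm 3.7 (3.87)–(3.90) pp.408–410 + Thm 3.1 (3.42)–(3.47) pp.397–398 + Cor. 3.6 p.408; Balaban1984PropagatorsII, Lemma 2.1 (2.60)–(2.61) p.234] -/
theorem thm37Printed_allPin_inputHolder {X Y ι PX PY : I → Type} [∀ i, Fintype (X i)] [∀ i, DecidableEq (X i)]
    [∀ i, Fintype (Y i)] [∀ i, DecidableEq (Y i)] [∀ i, Fintype (ι i)] [∀ i, Fintype (PX i)] [∀ i, DecidableEq (PX i)]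
    [∀ i, Fintype (PY i)] [∀ i, DecidableEq (PY i)]
    {𝔴 : ∀ i, B9.RWExpansion (geo i) (bg i)} {𝔬 : ∀ i, Ops (geo i) (bg i) (X i) (Y i) (ι i)}
    {R : I → ℝ} {H : I → Prop} {C δ : ℝ}
    (𝔭 : ∀ i, HolderProbes (geo i) (bg i) (X i) (Y i) (PX i) (PY i))
    (bH : ∀ i, ℝ → BlockNorm (toB6 (geo i) (R i) (H i)) (Y i → ℝ))
    (K : ∀ i, B9.KernelFamily (geo i) (bg i)) (ev : ∀ i, (geo i).Loc → X i → ℝ) (evY : ∀ i, (geo i).Loc → Y i → ℝ)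
    {d : ℕ} {α L₀ B₀ δ₀ Mg Mr ar : ℝ} {Bβ Bε : ℝ → ℝ} {Bεβ : ℝ → ℝ → ℝ}
    (κ : I → Sizes) (SH : ∀ i, ι i → Finset (geo i).Site) (Bl BV : ℝ → ℝ) (d₁ : ℕ)
    (δ₁ α₁ ρ N N' Cℓ Kc θ₀ B₁ NH a₁ M₁ ML : ℝ)
    (SL : ∀ i, ι i → Finset (geo i).Site) (NL BL MF : ℝ) (d₁' : ℕ)
    (SI : ∀ i, ι i → Finset (geo i).Site) (NI : ℝ) (BI θI : ℝ → ℝ) (BI2 : ℝ → ℝ → ℝ)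
    (h37 : B9.Thm37Printed c35 geo bg (fun i => E37OfOps (𝔴 i) (𝔬 i) (R i) (H i) C δ))
    (hco0 : ∀ i U, CoRealizes (K i) 0 U (𝔬 i).blk (𝔬 i).blk (ev i) ((𝔬 i).Gp U))
    (hco1 : ∀ i U, CoRealizes (K i) 1 U (𝔬 i).blkY (𝔬 i).blk (ev i) ((𝔬 i).D U ∘ₗ (𝔬 i).Gp U))
    (hco2 : ∀ i U, CoRealizes (K i) 2 U (𝔬 i).blk (𝔬 i).blkY (evY i) ((𝔬 i).Gp U ∘ₗ (𝔬 i).Dstar U))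
    (hco3 : ∀ i U, CoRealizes (K i) 3 U (𝔬 i).blk (𝔬 i).blk (ev i) ((𝔬 i).Lap U ∘ₗ (𝔬 i).Gp U))
    (hgl0 : ∀ i U, GlobReads (K i) 0 U (𝔬 i).blk (𝔬 i).blk (ev i) ((𝔬 i).Gp U))
    (hgl1 : ∀ i U, GlobReads (K i) 1 U (𝔬 i).blkY (𝔬 i).blk (ev i) ((𝔬 i).D U ∘ₗ (𝔬 i).Gp U))
    (hgl2 : ∀ i U, GlobReads (K i) 2 U (𝔬 i).blk (𝔬 i).blkY (evY i) ((𝔬 i).Gp U ∘ₗ (𝔬 i).Dstar U))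
    (hgl3 : ∀ i U, GlobReads (K i) 3 U (𝔬 i).blk (𝔬 i).blk (ev i) ((𝔬 i).Lap U ∘ₗ (𝔬 i).Gp U))
    (hl0 : ∀ i U, L2Reads (R := R i) (H := H i) (K i) 0 U (𝔬 i).blk (𝔬 i).blk (ev i) ((𝔬 i).Gp U))
    (hl1 : ∀ i U, L2Reads (R := R i) (H := H i) (K i) 1 U (𝔬 i).blkY (𝔬 i).blk (ev i) ((𝔬 i).D U ∘ₗ (𝔬 i).Gp U))
    (hl2 : ∀ i U, L2Reads (R := R i) (H := H i) (K i) 2 U (𝔬 i).blk (𝔬 i).blkY (evY i) ((𝔬 i).Gp U ∘ₗ (𝔬 i).Dstar U))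
    (hl3 : ∀ i U, L2Reads (R := R i) (H := H i) (K i) 3 U (𝔬 i).blk (𝔬 i).blk (ev i) ((𝔬 i).Lap U ∘ₗ (𝔬 i).Gp U))
    (hl5 : ∀ i U, L2Reads (R := R i) (H := H i) (K i) 5 U (𝔬 i).blk (𝔬 i).blk (ev i) ((𝔬 i).Gp U ∘ₗ (𝔬 i).Lap U))
    (hH1 : ∀ i U, H1Reads (K i) U (𝔭 i) (𝔬 i).blk (𝔬 i).blkY (ev i) (evY i) ((𝔬 i).D U ∘ₗ (𝔬 i).Gp U)
      ((𝔬 i).Gp U ∘ₗ (𝔬 i).Dstar U))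
    (hIR : ∀ i U, InputReads (K i) U (𝔭 i) (bH i) (𝔬 i).blkY (evY i) ((𝔬 i).D U ∘ₗ ((𝔬 i).Gp U ∘ₗ (𝔬 i).Dstar U)))
    (hsym : ∀ i U, IsTransposePair ((𝔬 i).Gp U) ((𝔬 i).Gp U))
    (htr : ∀ i U, IsTransposePair ((𝔬 i).D U ∘ₗ (𝔬 i).Gp U) ((𝔬 i).Gp U ∘ₗ (𝔬 i).Dstar U))
    (hadjL : ∀ i U, IsTransposePair ((𝔬 i).Lap U ∘ₗ (𝔬 i).Gp U) ((𝔬 i).Gp U ∘ₗ (𝔬 i).Lap U))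
    (hfacts : ∀ i, Mg ≤ (geo i).M → Facts347 (geo i) (R i) (H i) d δ α L₀)
    (hdsymm : ∀ i (a b : (geo i).Site), (geo i).dist a b = (geo i).dist b a)
    (hC : 0 ≤ C) (hCB : C ≤ B₀) (hCL : C * L₀ ≤ B₀) (hδ₀ : δ₀ ≤ (1 - α) * δ) (hα : 0 ≤ α * δ) (hαδ1 : α * δ ≤ δ)
    (hCg : C * B6.c1 d δ (1 - α) * L₀ ^ (4 : ℝ) ≤ B₀) (har : 0 < ar)
    (hc : 0 < c35) (ha₁ : 0 < a₁) (hα₁ : 0 ≤ α₁) (hα₁2 : α₁ ≤ 1 / 2) (hN' : 0 ≤ N') (hCℓ : 0 ≤ Cℓ)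
    (hB₁ : 0 ≤ B₁) (hNH : 0 ≤ NH) (hM₁ : 0 < M₁) (hδnn : 0 ≤ δ) (hδ5 : δ ≤ (1 - 2 * α₁) * δ₁) (hδ₁ : 0 ≤ δ₁) (hNL : 0 ≤ NL)
    (hBL : 0 ≤ BL) (hNI : 0 ≤ NI) (hB5 : Real.sqrt (C * lapConst d₁ δ₁ α₁ NL BL L₀) * L₀ ≤ B₀)
    (hst : ∀ i, StaticOK (𝔬 i) ρ N N' Cℓ (κ i)) (hκ : ∀ i, (κ i).Bounded Kc θ₀ Cℓ (geo i).M)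
    (hcntH : ∀ i (a : (geo i).Site), (∑ q, if a ∈ SH i q then (1 : ℝ) else 0) ≤ NH)
    (hcntL : ∀ i (a : (geo i).Site), (∑ q, if a ∈ SL i q then (1 : ℝ) else 0) ≤ NL)
    (hcntI : ∀ i (a : (geo i).Site), (∑ q, if a ∈ SI i q then (1 : ℝ) else 0) ≤ NI)
    (hBl : ∀ β, 0 ≤ β → β < 1 → 0 ≤ Bl β) (hBV : ∀ β, 0 ≤ β → β < 1 → 0 ≤ BV β)
    (hBI : ∀ ε, 0 < ε → ε ≤ 1 → 0 ≤ BI ε) (hBI2 : ∀ ε β, 0 < ε → ε ≤ 1 → 0 ≤ β → β < 1 → 0 ≤ BI2 ε β)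
    (hθI : ∀ ε, 0 < ε → 0 ≤ θI ε)
    (hBβ : ∀ β, 0 ≤ β → β < 1 → holderConst d₁ δ₁ α₁ NH N' C (Bl β) (BV β) ≤ Bβ β)
    (hBε : ∀ ε, 0 < ε → ε ≤ 1 → inputConst44 d₁ δ₁ α₁ NI N' C L₀ (BI ε) (θI ε) ≤ Bε ε)
    (hBεβ : ∀ ε β, 0 < ε → ε ≤ 1 → 0 ≤ β → β < 1 →
      inputConst45 d₁ δ₁ α₁ NI N' L₀ (holderConst d₁ δ₁ α₁ NH N' C (Bl β) (BV β)) (BI2 ε β) (θI (β + ε)) ≤ Bεβ ε β)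
    (h261 : ∀ i, ML ≤ (geo i).M → Ineq261 d₁ (toB6 (geo i) (R i) (H i)) δ₁ α₁)
    (hF₁ : ∀ i, MF ≤ (geo i).M → Facts347 (geo i) (R i) (H i) d₁' δ₁ α₁ L₀)
    (hop : ∀ i, M₁ ≤ (geo i).M → ∀ α₀ : ℝ, 0 < α₀ → c35 * (geo i).M * α₀ ≤ a₁ →
      ∀ U : (bg i).Cfg, (bg i).Reg335 c35 α₀ U →
        Local342 (𝔬 i) (R i) (H i) B₁ δ₁ U ∧ Identities (𝔬 i) (R i) (H i) U ∧
          HolderLegs37 (𝔬 i) (𝔭 i) (R i) (H i) (SH i) Bl δ₁ U ∧ HolderV37 (𝔬 i) (𝔭 i) (R i) (H i) BV δ₁ U)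
    (hopL : ∀ i, M₁ ≤ (geo i).M → ∀ α₀ : ℝ, 0 < α₀ → c35 * (geo i).M * α₀ ≤ a₁ →
      ∀ U : (bg i).Cfg, (bg i).Reg335 c35 α₀ U → LapLegs37 (𝔬 i) (R i) (H i) (SL i) BL δ₁ U)
    (hopI : ∀ i, M₁ ≤ (geo i).M → ∀ α₀ : ℝ, 0 < α₀ → c35 * (geo i).M * α₀ ≤ a₁ →
      ∀ U : (bg i).Cfg, (bg i).Reg335 c35 α₀ U →
        InputLegs37 (𝔬 i) (𝔭 i) (R i) (H i) (bH i) (SI i) BI BI2 δ₁ U ∧ FactorsInput37 (𝔬 i) (R i) (H i) (bH i) θI δ₁ U)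
    -- the displayed residual: the L² line n = 4 only
    (hrest : ∀ i, Mr ≤ (geo i).M → ∀ α₀ : ℝ, 0 < α₀ → (geo i).M * α₀ ≤ ar → ∀ U : (bg i).Cfg, (bg i).Reg335 c35 α₀ U →
      ∀ (lam : (geo i).Loc) (h : (geo i).Cut) (y y' : (geo i).Site), (geo i).cutIn h y → (geo i).suppIn lam y' →
        (K i).l2 4 U lam h ≤ B₀ * B9.pref6 ((geo i).len y) 4 * (geo i).cutSup h * Real.exp (-(δ₀ * (geo i).dist y y')) *
          (geo i).l2Norm lam) :
    B9.Thm37Printed c35 geo bg (fun i => E37AllOfOps (𝔴 i) (𝔬 i) (R i) (H i) C δ (K i) B₀ δ₀ Bβ Bε Bεβ) := by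
  have hαδ₁ : 0 ≤ α₁ * δ₁ := mul_nonneg hα₁ hδ₁
  have hδδ₁ : δ ≤ (1 - α₁) * δ₁ := hδ5.trans (by nlinarith [hαδ₁])
  have hα₁1 : α₁ ≤ 1 := by linarith
  have h37' := h37
  obtain ⟨M₂, a₀, hM₂, ha₀, hE⟩ := h37'
  set Mbig : ℝ := 2 * N' * (B₁ * Real.exp (δ₁ * ρ) * θ₀) * B6.c1 d₁ δ₁ α₁ with hMbig
  refine thm37Printed_allPin_schur_holder_lap (Mr := max (max Mr Mg) (max (max M₂ M₁) (max (max ML MF) Mbig)))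
    (ar := min (min ar a₀) (a₁ / c35)) 𝔭 K ev evY κ SH Bl BV d₁ δ₁ α₁ ρ N N' Cℓ Kc θ₀ B₁ NH a₁ M₁ ML SL NL BL MF d₁' h37
    hco0 hco1 hco2 hco3 hgl0 hgl1 hgl2 hgl3 hl0 hl1 hl2 hl3 hl5 hH1 hsym htr hadjL hfacts hdsymm hC hCB hCL hδ₀ hα hCg
    (lt_min (lt_min har ha₀) (div_pos ha₁ hc)) hc ha₁ hα₁ hα₁2 hN' hCℓ hB₁ hNH hM₁ hδnn hδ5 hδ₁ hNL hBL hB5 hst hκ hcntH hcntL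
    hBl hBV hBβ h261 hF₁ hop hopL fun i hM α₀ hα₀ hMa U hU => ?_
  have hMr : Mr ≤ (geo i).M := le_trans (le_trans (le_max_left _ _) (le_max_left _ _)) hM
  have hMg : Mg ≤ (geo i).M := le_trans (le_trans (le_max_right _ _) (le_max_left _ _)) hM
  have hM₂i : M₂ ≤ (geo i).M := le_trans (le_trans (le_trans (le_max_left _ _) (le_max_left _ _)) (le_max_right _ _)) hM
  have hM₁i : M₁ ≤ (geo i).M := le_trans (le_trans (le_trans (le_max_right _ _) (le_max_left _ _)) (le_max_right _ _)) hM
  have hMLi : ML ≤ (geo i).M :=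
    le_trans (le_trans (le_trans (le_trans (le_max_left _ _) (le_max_left _ _)) (le_max_right _ _)) (le_max_right _ _)) hM
  have hMFi : MF ≤ (geo i).M :=
    le_trans (le_trans (le_trans (le_trans (le_max_right _ _) (le_max_left _ _)) (le_max_right _ _)) (le_max_right _ _)) hM
  have hMb : Mbig ≤ (geo i).M := le_trans (le_trans (le_trans (le_max_right _ _) (le_max_right _ _)) (le_max_right _ _)) hM
  have hMpos : 0 < (geo i).M := lt_of_lt_of_le hM₂ hM₂i
  have hMa_ar : (geo i).M * α₀ ≤ ar := hMa.trans ((min_le_left _ _).trans (min_le_left _ _))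
  have hMa₀ : (geo i).M * α₀ ≤ a₀ := hMa.trans ((min_le_left _ _).trans (min_le_right _ _))
  have ha : c35 * (geo i).M * α₀ ≤ a₁ := by
    have h1 : (geo i).M * α₀ * c35 ≤ a₁ := (le_div_iff₀ hc).mp (hMa.trans (min_le_right _ _))
    calc c35 * (geo i).M * α₀ = (geo i).M * α₀ * c35 := by ring
      _ ≤ a₁ := h1
  have h4 := hrest i hMr α₀ hα₀ hMa_ar U hU
  have hconv : Conv342 (𝔬 i) (R i) (H i) C δ U := hE i hM₂i α₀ hα₀ hMa₀ U hU
  obtain ⟨-, h1, h2, -⟩ := hconv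
  obtain ⟨hl, hi, hL, hV⟩ := hop i hM₁i α₀ hα₀ ha U hU
  obtain ⟨hIL, hFI⟩ := hopI i hM₁i α₀ hα₀ ha U hU
  have hBe : 0 ≤ B₁ * Real.exp (δ₁ * ρ) := mul_nonneg hB₁ (Real.exp_nonneg _)
  have hq : N' * (B₁ * Real.exp (δ₁ * ρ) * ((κ i).kP + (κ i).kC)) * B6.c1 d₁ δ₁ α₁ ≤ 1 / 2 :=
    small_of_size₃ hN' hBe (c1_nonneg d₁ δ₁ α₁) hMpos (hκ i).row (by rw [hMbig] at hMb; exact hMb)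
  have hF := hfacts i hMg
  have hL₀ : 0 ≤ L₀ := le_trans (le_trans zero_le_one hF.one_le_L) hF.L_le
  have hlen : ∀ y : (geo i).Site, 0 < (geo i).len y := (hst i).lenpos
  obtain ⟨h44, h45⟩ := input3445_of_local37 (𝔬 i) (𝔭 i) (R i) (H i) (bH i) d d₁ δ α L₀ δ₁ α₁ ρ B₁ N N' Cℓ NH NI C (κ i)
    (SH i) (SI i) Bl BV BI θI BI2 U hB₁ hδ₁ hα₁ hα₁1 hN' hNH hNI hC hδnn hδδ₁ hα hαδ1 (hst i) (hκ i).nonneg (hcntH i) (hcntI i)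
    hBl hBV hBI hBI2 hθI (h261 i hMLi) hF hq hl hi hL hV hIL hFI h1 h2
  have hexp : ∀ a b : (geo i).Site, Real.exp (-((1 - α) * δ * (geo i).dist a b)) ≤ Real.exp (-(δ₀ * (geo i).dist a b)) :=
    fun a b => Real.exp_le_exp.mpr (neg_le_neg (mul_le_mul_of_nonneg_right hδ₀ ((hst i).dnn a b)))
  have hK44 : ∀ ε, 0 < ε → ε ≤ 1 → 0 ≤ inputConst44 d₁ δ₁ α₁ NI N' C L₀ (BI ε) (θI ε) := by
    intro ε hε0 hε1
    have hb := hBI ε hε0 hε1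
    have ht := hθI ε hε0
    have hc1 : 0 ≤ B6.c1 d₁ δ₁ α₁ := c1_nonneg d₁ δ₁ α₁
    unfold inputConst44
    positivity
  have hK45 : ∀ ε β, 0 < ε → ε ≤ 1 → 0 ≤ β → β < 1 →
      0 ≤ inputConst45 d₁ δ₁ α₁ NI N' L₀ (holderConst d₁ δ₁ α₁ NH N' C (Bl β) (BV β)) (BI2 ε β) (θI (β + ε)) := by
    intro ε β hε0 hε1 hβ0 hβ1
    have hb := hBI2 ε β hε0 hε1 hβ0 hβ1
    have ht := hθI (β + ε) (by linarith)
    have hbl := hBl β hβ0 hβ1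
    have hbv := hBV β hβ0 hβ1
    have hc1 : 0 ≤ B6.c1 d₁ δ₁ α₁ := c1_nonneg d₁ δ₁ α₁
    unfold inputConst45 holderConst
    positivity
  have h44' : ∀ ε, 0 < ε → ε ≤ 1 → HasMaj (bH i ε) (BlockNorm.ofBlocks (toB6 (geo i) (R i) (H i)) (𝔬 i).blkY)
      ((𝔬 i).D U ∘ₗ ((𝔬 i).Gp U ∘ₗ (𝔬 i).Dstar U)) (fun (a b : (geo i).Site) => Bε ε * Real.exp (-(δ₀ * (geo i).dist a b))) :=
    fun ε hε0 hε1 => (h44 ε hε0 hε1).mono fun a b =>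
      mul_le_mul (hBε ε hε0 hε1) (hexp a b) (Real.exp_nonneg _) ((hK44 ε hε0 hε1).trans (hBε ε hε0 hε1))
  have h45' : ∀ ε β, 0 < ε → ε ≤ 1 → 0 ≤ β → β < 1 →
      HasMaj (bH i (β + ε)) (BlockNorm.ofBlocks (toB6 (geo i) (R i) (H i)) (𝔭 i).blkPY)
        ((𝔭 i).ΦY U β ∘ₗ ((𝔬 i).D U ∘ₗ ((𝔬 i).Gp U ∘ₗ (𝔬 i).Dstar U)))
        (fun (a b : (geo i).Site) => Bεβ ε β * (geo i).len a ^ (-β) * Real.exp (-(δ₀ * (geo i).dist a b))) := by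
    intro ε β hε0 hε1 hβ0 hβ1
    refine (h45 ε β hε0 hε1 hβ0 hβ1).mono fun a b => ?_
    have hW : 0 ≤ (geo i).len a ^ (-β) := Real.rpow_nonneg (hlen a).le _
    exact mul_le_mul (mul_le_mul_of_nonneg_right (hBεβ ε β hε0 hε1 hβ0 hβ1) hW) (hexp a b) (Real.exp_nonneg _)
      (mul_nonneg ((hK45 ε β hε0 hε1 hβ0 hβ1).trans (hBεβ ε β hε0 hε1 hβ0 hβ1)) hW)
  have hBε0 : ∀ ε, 0 < ε → ε ≤ 1 → 0 ≤ Bε ε := fun ε hε0 hε1 => (hK44 ε hε0 hε1).trans (hBε ε hε0 hε1)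
  have hBεβ0 : ∀ ε β, 0 < ε → ε ≤ 1 → 0 ≤ β → β < 1 → 0 ≤ Bεβ ε β := fun ε β hε0 hε1 hβ0 hβ1 =>
    (hK45 ε β hε0 hε1 hβ0 hβ1).trans (hBεβ ε β hε0 hε1 hβ0 hβ1)
  obtain ⟨h344, h345⟩ := lines3445_of_hasMaj (hIR i U) hBε0 hBεβ0 hlen h44' h45'
  exact ⟨h344, h345, h4⟩

end AllPinsGp

end

end Literature.MathematicalPhysics.QuantumFieldTheory.Balaban1983to89.B9RWSums344InputGp
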